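import Literature.MathematicalPhysics.QuantumFieldTheory.Balaban1983to89.B8Thm4ConcreteLanE
import Literature.MathematicalPhysics.QuantumFieldTheory.Balaban1983to89.B8Prop3GaugeFixedKLevelSrcGammaPrime
import Literature.MathematicalPhysics.QuantumFieldTheory.Balaban1983to89.B8Thm4ExistsConcreteGamma

/-!
# `Balaban1983to89.B8Thm4ConcreteLanEGamma` — [Balaban1985RegularSpaces] Thm 4 p. 88 ∕ Thm 8 (1.146) p. 101 on the concrete `ℤᵈ × 𝔸` carriers in the
# leaf's quantifier shape, source-indexed gauge predicate (`B8Thm4ConcreteLanE`) — EDITION γ′: the averaging-datum class `Λb` a PARAMETER under PRINT's box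
# law «box ⊂ Ω_{j−1}» ((1.31) p. 82, crossing contours included), (1.35) READ IN PRINT's ONE-END-POINT CLASS (p. 77) in the datum and in every socket's
# antecedent (= dag-n05-w1's P-carrier letter `B8LeafModelZd3P.zdGF3P.avgClose`), the tower law at every truncation; existence by this seat's
# `B8Prop3GaugeFixedKLevelSrcGammaPrime.thm4_exists_all_levels_supp_src_γ'` (dag-n05-w2's `H42_of_inAx_γ'` inside), γ windows by dag-n05-e's
# `B8Thm4ExistsConcreteGamma.thm4_windows_γ`, uniqueness `B8Thm4UniqueELan.thm4_unique_eq_lanE` unchanged (class-free) — D7-3(A) of the `Ω₀ = ℤᵈ` road's γ chain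

statement-level skeleton of published theorems with citation tags; proofs where landed; nothing here is a claim about the Yang–Mills mass gap

T. Bałaban, *Spaces of regular gauge field configurations on a lattice and gauge fixing conditions*, Commun. Math. Phys. **99** (1985) 75–102
`[Balaban1985RegularSpaces]` ("B8"): Thm 4 p. 88, (1.29) p. 81, (1.31) p. 82, (1.35) p. 82, (1.38) p. 82, (1.62) p. 87, Prop. 5 (1.108)–(1.109) p. 94, pp. 94–95,
Thm 8 (1.146) p. 101, p. 77 (bond convention «at least one end-point of b belongs to Ω»).  PDF held: `paper:balaban1985-cmp99-regular-spaces-gauge-fixing`.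

CITATION HEADER (lean-in-tree rule).  Cell `pub-ymgap` (HUMAN RULING D-0062, Track A), DAG node N05 = [B8], seat `pub-ymgap-dag-n05-d` (g10; R134 row s2).
WHY THIS FILE.  See `B8Prop3ShellModeVacuity` (p585094: the N05 slot is EMPTY as typed — (1.42) on the narrow class) and the design convergence of
2026-08-28 00:05–00:14Z (P-carrier `zdGF3P` with `C137` on `towerBondsP` and (1.35)∕(1.66) in the one-end-point class).  This is the Thm-4∕Thm-8 concrete body
the P-carrier core (`B8Thm4CoreZd3LanE` twin, next) and the Thm-8 knit (`B8Thm8SurvivingZd3MapHE` twin) will read; `B8Thm4ConcreteLanE` VERBATIM except: `hbox`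
at `Ω (j − 1)`; `htw`; the five (1.35) binders in the one-end-point form; the (1.42)-feeding windows at `(L²α₀, L·α₂)` and the (1.61)-constant L²-scaled, taken
from `thm4_windows_γ` at `B₈` (threshold `min … cγ`); the existence step `thm4_exists_all_levels_supp_src_γ'`.

WHAT THIS FILE PROVES (one theorem, no `def`): ★★ `thm4Body_concrete_uniform_lanE_γ'`.

HONEST SCOPE.  Assembly BY NAME; Prop. 5's three sockets and the sourced in-edge `SH59src` are HYPOTHESES (now with the one-end-point (1.35) antecedent —
providers: dag-n05-w4's γ∕γ′ Src chain); the class laws are hypotheses on `Λb` (inhabited by `towerBondsP` ∕ `cubeLamBP'`); count-neutral; N05 NOT discharged;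
`≤` where print has `<`; `T_η ↦ ℤᵈ`; one finite `T⁴` programme at fixed `ε` — nothing continuum ∕ ℝ⁴ ∕ OS ∕ mass-gap ∕ Clay.  No `sorry`, no `def`, no
`instance`, no `notation`.  Unit `pub-ymgap-dag-n05-d` (g10), 2026-08-28.
-/

noncomputable section

open NormedSpace

namespace Literature.MathematicalPhysics.QuantumFieldTheory.Balaban1983to89.B8Thm4ConcreteLanEGamma

open Complex (I I_ne_zero)
open MatrixLog B7Prop1Explicit B7Prop2Explicit B7Prop1Local B7Eq92Concrete
open B7Prop2Explicit (C0 c2' unitaryUnits unitaryUnits_le_U1 avgClosed_unitaryUnits)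
open B8Lemma1NonAbelian (mulCfg)
open B8Ineq132 (covDerivFwd covDeriv covDiv plaqF InAk CondAt BondTouches PlaqTouches)
open B8Eq140Level (SideTouches)
open B8Eq119TwistedAxial (Restr129 InAx)
open B8Eq184Proof (gaugeExp cfgExp)
open B8Eq146AExpansion (iEta)
open B7Prop4GeneralLevels (logCovIter linCovIter)
open B8Eq155JBound (Jcur wsup)
open B8ScaledSupNorm (bondNorm msup)
open B7Prop3Flat (c3)
open B8Thm2LogB (blockTop)
open B8Ineq130 (tlo thi)
open B8Eq138LandauZd (logCfg)
open B8Prop3GaugeFixedKLevel (eq_mgauge_inv_of_mgauge_eq mem_unitaryUnits_of_mgauge_eq logField_spec)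
open B8Thm4Concrete (mulCfg_eq_mul)
open B8Prop3GaugeFixedKLevelSrcGammaPrime (thm4_exists_all_levels_supp_src_γ')
open B8Thm4UniqueELan (thm4_unique_eq_lanE)
open B8Thm4Windows (thm4_windows thm4_windows_extra)
open B8Thm4ExistsConcreteGamma (thm4_windows_γ)

-- `Site` alone could resolve to the torus sites of `Setup.lean`; re-export the `ℤ^d` sites of `B7Prop1Explicit`.
export B7Prop1Explicit (Site)

variable {d : ℕ}

section Main

variable {𝔸 : Type*} [CStarAlgebra 𝔸] [Nontrivial 𝔸]

/-- ★★ **THEOREM 4 ∕ THEOREM 8 ON THE CONCRETE CARRIERS IN THE LEAF's QUANTIFIER SHAPE, SOURCE-INDEXED GAUGE PREDICATE, MEMBER-UNIFORM THRESHOLD,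
PROPOSITION 5's UNIQUENESS SOCKET IN THE REPAIRED («E») CURRENCY — EDITION γ′** (datum class `Λb` a PARAMETER under print's box law «box ⊂ Ω_{j−1}»;
(1.35) read in PRINT's one-end-point class in the datum AND in every socket's antecedent; tower law at every truncation; existence by
`B8Prop3GaugeFixedKLevelSrcGammaPrime.thm4_exists_all_levels_supp_src_γ'`, γ windows by `B8Thm4ExistsConcreteGamma.thm4_windows_γ`; uniqueness unchanged) (module docstring).  `B8Thm4ConcreteLan.thm4Body_concrete_uniform_lan` VERBATIM except
the binder `SP5u` (:= `B8LeafModelZdSockP5uE.SockP5uE`'s text with `IsLandau138W … W ↦ LanF U₀ φ k W`, the source premiss, and the (1.62)-constant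
`5dL·B₈(α₀ + α₁)`) and the last step (`B8Thm4UniqueELan.thm4_unique_eq_lanE`).  As there, relative to `B8Thm4Concrete.thm4Body_concrete_uniform`:
every datum carries a source index `φ : Φ` admitted by `Adm φ U₀ α₀ α₁` (a premiss of every socket and of the conclusion); the gauge predicate is the family `LanF U₀ φ m`; the b9 socket `SH59src`
carries `+ γ′B₀(α₀ + α₁)` on both (1.59)-lines; the (1.62)-constant is `5dL·B₈(α₀ + α₁)` with `B₀ ≤ B₈`, `5dLB₀ + 2γ′B₀ ≤ 5dLB₈`, `2 ≤ 5dLB₈`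
(p. 89 «B₁ not too small»).  For Theorem 8 read `Φ := Site d → 𝔸`, `LanF U₀ f k := IsLandau146W L k η (Ω 0) (Λs k) U₀ f` (1.146) and
`Adm f U₀ α₀ α₁ :=` «f from R(U₀), |f|₍₋₂₎ ≤ γ(α₀ + α₁)»; for Theorem 4, `Φ := Unit`, `γ′ := 0`, `B₈ := B₀`.
[cite: Balaban1985RegularSpaces, Thm 8 (1.146) p.101, Thm 4 p.88, (1.29) p.81, (1.38) p.82, (1.62) p.87, Prop. 5 (1.108)–(1.109) p.94, pp.94–95] -/
theorem thm4Body_concrete_uniform_lanE_γ' (hd2 : 2 ≤ d) {L : ℕ} (hL : 2 ≤ L)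
    {B₀ B₀' cu cP : ℝ} (hB₀ : 0 < B₀) (hB₀' : 0 < B₀') (hcu : 0 < cu) (hcP : 0 < cP)
    -- the source: an index type `Φ` and the source constants (fixed before the threshold); the admissibility predicate `Adm` read by the
    -- providers and the gauge predicate family `LanF` are quantified AFTER the threshold (they may depend on the member), like the member data
    {Φ : Type*} {γ' B₈ : ℝ} (hγ' : 0 ≤ γ') (hB₈ : 0 < B₈) (hB₀8 : B₀ ≤ B₈) (hB : 2 ≤ 5 * (d : ℝ) * L * B₈)
    (hγB : 5 * (d : ℝ) * L * B₀ + 2 * (γ' * B₀) ≤ 5 * (d : ℝ) * L * B₈) :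
    ∃ c₁ : ℝ, 0 < c₁ ∧ ∀ (Adm : Φ → (Site d → Fin d → 𝔸ˣ) → ℝ → ℝ → Prop)
    (LanF : (Site d → Fin d → 𝔸ˣ) → Φ → ℕ → (Site d → Fin d → 𝔸ˣ) → Prop) (η : ℝ), 0 < η → ∀ (k : ℕ)
    (Ω : ℕ → Set (Site d)) (hΩ : ∀ j, Ω (j + 1) ⊆ Ω j) (Λs : ℕ → ℕ → Set (Site d)) (Λb : ℕ → ℕ → Set (Site d × Fin d))
    -- PRINT's box law (edition γ): the locality box of a level-`j` datum bond lies in `Ω_{j−1}` ((1.31); level 0: `Ω₀`)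
    (hbox : ∀ m, m ≤ k → ∀ j, j ≤ m → ∀ c ∈ Λb m j, ∀ x, InBox (loK L j c.1) (bondHiK L j c.1 c.2) x → x ∈ Ω (j - 1))
    (hclass : ∀ m, m ≤ k → ∀ j, j ≤ m → ∀ c ∈ Λb m j,
      (c.1 ∈ Λs m j ∧ c.1 + e c.2 ∈ Λs m j) ∨
      (∃ j', j = j' + 1 ∧ (∀ x, (L : ℤ) • c.1 ≤ x → x ≤ (L : ℤ) • c.1 + blockTop L → x ∈ Λs m j') ∧ c.1 + e c.2 ∈ Λs m j) ∨
      (∃ j', j = j' + 1 ∧ c.1 ∈ Λs m j ∧ (∀ x, (L : ℤ) • (c.1 + e c.2) ≤ x → x ≤ (L : ℤ) • (c.1 + e c.2) + blockTop L → x ∈ Λs m j')))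
    (htower : ∀ j, j ≤ k → ∀ y ∈ Λs k j, ∀ x, InBox (tlo L y j) (thi L y j) x → x ∈ Ω j)
    (hpart : ∀ x, x ∈ Ω 0 → ∃ j, j ≤ k ∧ ∃ y ∈ Λs k j, InBox (tlo L y j) (thi L y j) x)
    -- the tower law AT EVERY TRUNCATION `m ≤ k` ((1.5)–(1.6) p. 77; `IdxB8Sub.tower_all` at the law members) — read by the γ′ (1.42) lemma
    (htw : ∀ m, m ≤ k → ∀ j, j ≤ m → ∀ y ∈ Λs m j, ∀ x, InBox (tlo L y j) (thi L y j) x → x ∈ Ω j)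
    (SP5base : ∀ α₀ α₁ : ℝ, 0 < α₀ → 0 < α₁ → α₀ + α₁ ≤ cP →
      ∀ U₀ U' : Site d → Fin d → 𝔸ˣ, (∀ x κ, U₀ x κ ∈ unitaryUnits 𝔸) → (∀ x κ, U' x κ ∈ unitaryUnits 𝔸) →
      ∀ φ : Φ, Adm φ U₀ α₀ α₁ →
      InAk L k η α₀ Ω U₀ → InAk L k η α₀ Ω (mulCfg U' U₀) → (∀ m, m ≤ k → InAx L m (Λs m) U₀ (mulCfg U' U₀)) →
      (∀ j, j ≤ k → ∀ (z : Site d) (μ : Fin d),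
        ((∀ x, InBox (tlo L z j) (thi L z j) x → x ∈ Ω j) ∨ (∀ x, InBox (tlo L (z + e μ) j) (thi L (z + e μ) j) x → x ∈ Ω j)) →
        ‖(avgIter L (mulCfg U' U₀) j z μ : 𝔸) - (avgIter L U₀ j z μ : 𝔸)‖ ≤ α₁) →
      (∀ b ∈ {b : Site d × Fin d | SideTouches (Ω 0) b.1 b.2}, ‖((U' b.1 b.2 : 𝔸ˣ) : 𝔸) - 1‖ ≤ α₁) →
      (∃ (v : Site d → 𝔸ˣ) (lam : Site d → 𝔸), (∀ x, v x ∈ unitaryUnits 𝔸) ∧ (∀ x, x ∉ Ω 0 → v x = 1) ∧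
        (∀ j, j ≤ 1 → ∀ b ∈ {b : Site d × Fin d | SideTouches (Ω j) b.1 b.2}, (v b.1 : 𝔸) = ((gaugeExp lam b.1 : 𝔸ˣ) : 𝔸) ∧
        (v (b.1 + e b.2) : 𝔸) = ((gaugeExp lam (b.1 + e b.2) : 𝔸ˣ) : 𝔸)) ∧
        (∀ j, j ≤ 1 → ∀ b ∈ {b : Site d × Fin d | SideTouches (Ω j) b.1 b.2},
        ‖lam b.1‖ ≤ (8 * B₀' * (5 * (d : ℝ) * L * B₈) * (α₀ + α₁)) ∧ ((L : ℝ) ^ j * η) * ‖covDerivFwd η U₀ b.2 lam b.1‖ ≤ (8 * B₀' * (5 * (d : ℝ) * L * B₈) * (α₀ + α₁))) ∧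
        LanF U₀ φ 1 (mgauge U₀ v⁻¹ U') ∧ Restr129 L 1 (Λs 1) U₀ ((1 : Site d → 𝔸ˣ) * v)))
    (SP5 : ∀ α₀ α₁ : ℝ, 0 < α₀ → 0 < α₁ → α₀ + α₁ ≤ cP →
      ∀ U₀ U' : Site d → Fin d → 𝔸ˣ, (∀ x κ, U₀ x κ ∈ unitaryUnits 𝔸) → (∀ x κ, U' x κ ∈ unitaryUnits 𝔸) →
      ∀ φ : Φ, Adm φ U₀ α₀ α₁ →
      InAk L k η α₀ Ω U₀ → InAk L k η α₀ Ω (mulCfg U' U₀) → (∀ m, m ≤ k → InAx L m (Λs m) U₀ (mulCfg U' U₀)) →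
      (∀ j, j ≤ k → ∀ (z : Site d) (μ : Fin d),
        ((∀ x, InBox (tlo L z j) (thi L z j) x → x ∈ Ω j) ∨ (∀ x, InBox (tlo L (z + e μ) j) (thi L (z + e μ) j) x → x ∈ Ω j)) →
        ‖(avgIter L (mulCfg U' U₀) j z μ : 𝔸) - (avgIter L U₀ j z μ : 𝔸)‖ ≤ α₁) →
      (∀ b ∈ {b : Site d × Fin d | SideTouches (Ω 0) b.1 b.2}, ‖((U' b.1 b.2 : 𝔸ˣ) : 𝔸) - 1‖ ≤ α₁) →
      (∀ m, 1 ≤ m → m < k → ∀ (u₁ : Site d → 𝔸ˣ) (U₁ : Site d → Fin d → 𝔸ˣ) (A : Site d → Fin d → 𝔸),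
        (∀ x, u₁ x ∈ unitaryUnits 𝔸) → (∀ x, x ∉ Ω 0 → u₁ x = 1) → mgauge U₀ u₁ U₁ = U' → Restr129 L m (Λs m) U₀ u₁ →
        LanF U₀ φ m U₁ →
        (∀ j, j ≤ m → ∀ b ∈ {b : Site d × Fin d | SideTouches (Ω j) b.1 b.2},
        U₁ b.1 b.2 = cfgExp η A b.1 b.2 ∧ IsSelfAdjoint (A b.1 b.2) ∧ ‖A b.1 b.2‖ ≤ (5 * (d : ℝ) * L * B₈ * (α₀ + α₁)) * ((L : ℝ) ^ j * η)⁻¹) →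
        ∃ (v : Site d → 𝔸ˣ) (lam : Site d → 𝔸), (∀ x, v x ∈ unitaryUnits 𝔸) ∧ (∀ x, x ∉ Ω 0 → v x = 1) ∧
        (∀ j, j ≤ m + 1 → ∀ b ∈ {b : Site d × Fin d | SideTouches (Ω j) b.1 b.2}, (v b.1 : 𝔸) = ((gaugeExp lam b.1 : 𝔸ˣ) : 𝔸) ∧
        (v (b.1 + e b.2) : 𝔸) = ((gaugeExp lam (b.1 + e b.2) : 𝔸ˣ) : 𝔸)) ∧
        (∀ j, j ≤ m + 1 → ∀ b ∈ {b : Site d × Fin d | SideTouches (Ω j) b.1 b.2},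
        ‖lam b.1‖ ≤ (8 * B₀' * (5 * (d : ℝ) * L * B₈) * (α₀ + α₁)) ∧ ((L : ℝ) ^ j * η) * ‖covDerivFwd η U₀ b.2 lam b.1‖ ≤ (8 * B₀' * (5 * (d : ℝ) * L * B₈) * (α₀ + α₁))) ∧
        LanF U₀ φ (m + 1) (mgauge U₀ v⁻¹ U₁) ∧ Restr129 L (m + 1) (Λs (m + 1)) U₀ (u₁ * v)))
    (SH59src : ∀ α₀ α₁ : ℝ, 0 < α₀ → 0 < α₁ → α₀ + α₁ ≤ cP →
      ∀ U₀ U' : Site d → Fin d → 𝔸ˣ, (∀ x κ, U₀ x κ ∈ unitaryUnits 𝔸) → (∀ x κ, U' x κ ∈ unitaryUnits 𝔸) →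
      ∀ φ : Φ, Adm φ U₀ α₀ α₁ →
      InAk L k η α₀ Ω U₀ → InAk L k η α₀ Ω (mulCfg U' U₀) → (∀ m, m ≤ k → InAx L m (Λs m) U₀ (mulCfg U' U₀)) →
      (∀ j, j ≤ k → ∀ (z : Site d) (μ : Fin d),
        ((∀ x, InBox (tlo L z j) (thi L z j) x → x ∈ Ω j) ∨ (∀ x, InBox (tlo L (z + e μ) j) (thi L (z + e μ) j) x → x ∈ Ω j)) →
        ‖(avgIter L (mulCfg U' U₀) j z μ : 𝔸) - (avgIter L U₀ j z μ : 𝔸)‖ ≤ α₁) →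
      (∀ b ∈ {b : Site d × Fin d | SideTouches (Ω 0) b.1 b.2}, ‖((U' b.1 b.2 : 𝔸ˣ) : 𝔸) - 1‖ ≤ α₁) →
      (∀ m, 1 ≤ m → m ≤ k → ∀ (u : Site d → 𝔸ˣ) (W : Site d → Fin d → 𝔸ˣ) (A' : Site d → Fin d → 𝔸),
        (∀ x, u x ∈ unitaryUnits 𝔸) → mgauge U₀ u W = U' → Restr129 L m (Λs m) U₀ u → LanF U₀ φ m W →
        (∀ y τ, IsSelfAdjoint (A' y τ)) →
        (∀ j, j ≤ m → ∀ y τ, SideTouches (Ω j) y τ →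
        W y τ = cfgExp η A' y τ ∧ ‖A' y τ‖ ≤ (2 * (L * (5 * (d : ℝ) * L * B₈ * (α₀ + α₁))) + 8 * (8 * B₀' * (5 * (d : ℝ) * L * B₈) * (α₀ + α₁))) * ((L : ℝ) ^ j * η)⁻¹) →
        (∀ y τ, (∀ j, j ≤ m → ¬ SideTouches (Ω j) y τ) → A' y τ = 0) →
        msup L m η (-(1 : ℝ)) (fun j (b : Site d × Fin d) => SideTouches (Ω j) b.1 b.2) (fun b => A' b.1 b.2)
        ≤ B₀ * (bondNorm L m η (-(3 : ℝ)) Ω (fun x μ => Jcur η U₀ A' μ x)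
        + wsup 1 (fun p : {p : ℕ × (Site d × Fin d) // p.1 ≤ m ∧ p.2 ∈ Λb m p.1} =>
        linCovIter L U₀ (iEta η A') p.1.1 p.1.2.1 p.1.2.2)) + γ' * B₀ * (α₀ + α₁) ∧
        msup L m η (-(2 : ℝ)) (fun j (t : Fin d × Fin d × Site d) => SideTouches (Ω j) t.2.2 t.2.1)
        (fun t => covDerivFwd η U₀ t.1 (fun z => A' z t.2.1) t.2.2)
        ≤ B₀ * (bondNorm L m η (-(3 : ℝ)) Ω (fun x μ => Jcur η U₀ A' μ x)
        + wsup 1 (fun p : {p : ℕ × (Site d × Fin d) // p.1 ≤ m ∧ p.2 ∈ Λb m p.1} =>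
        linCovIter L U₀ (iEta η A') p.1.1 p.1.2.1 p.1.2.2)) + γ' * B₀ * (α₀ + α₁)))
    (SP5u : ∀ α₀ α₁ : ℝ, 0 < α₀ → 0 < α₁ → α₀ + α₁ ≤ cP →
      ∀ U₀ U' : Site d → Fin d → 𝔸ˣ, (∀ x κ, U₀ x κ ∈ unitaryUnits 𝔸) → (∀ x κ, U' x κ ∈ unitaryUnits 𝔸) →
      ∀ φ : Φ, Adm φ U₀ α₀ α₁ →
      InAk L k η α₀ Ω U₀ → InAk L k η α₀ Ω (mulCfg U' U₀) → (∀ m, m ≤ k → InAx L m (Λs m) U₀ (mulCfg U' U₀)) →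
      (∀ j, j ≤ k → ∀ (z : Site d) (μ : Fin d),
        ((∀ x, InBox (tlo L z j) (thi L z j) x → x ∈ Ω j) ∨ (∀ x, InBox (tlo L (z + e μ) j) (thi L (z + e μ) j) x → x ∈ Ω j)) →
        ‖(avgIter L (mulCfg U' U₀) j z μ : 𝔸) - (avgIter L U₀ j z μ : 𝔸)‖ ≤ α₁) →
      (∀ b ∈ {b : Site d × Fin d | SideTouches (Ω 0) b.1 b.2}, ‖((U' b.1 b.2 : 𝔸ˣ) : 𝔸) - 1‖ ≤ α₁) →
      ∀ u₁ : Site d → 𝔸ˣ, (∀ x, u₁ x ∈ unitaryUnits 𝔸) → (∀ x, x ∉ Ω 0 → u₁ x = 1) → Restr129 L k (Λs k) U₀ u₁ →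
      LanF U₀ φ k (mgauge U₀ u₁⁻¹ U') →
      (∃ A₁ : Site d → Fin d → 𝔸, ∀ j, j ≤ k → ∀ (x : Site d) (κ : Fin d), SideTouches (Ω j) x κ →
        mgauge U₀ u₁⁻¹ U' x κ = cfgExp η A₁ x κ ∧ ‖A₁ x κ‖ ≤ (5 * (d : ℝ) * L * B₈ * (α₀ + α₁)) * ((L : ℝ) ^ j * η)⁻¹) →
      ∀ (v w : Site d → 𝔸ˣ) (lam mu : Site d → 𝔸),
      (∀ x, ((gaugeExp lam x : 𝔸ˣ) : 𝔸) = ((v x : 𝔸ˣ) : 𝔸) ∧ IsSelfAdjoint (lam x) ∧ ‖lam x‖ < cu) → (∀ x, x ∉ Ω 0 → lam x = 0) →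
      (∀ j, j ≤ k → ∀ b ∈ {b : Site d × Fin d | SideTouches (Ω j) b.1 b.2}, ((L : ℝ) ^ j * η) * ‖covDerivFwd η U₀ b.2 lam b.1‖ < cu) →
      (∀ x, ((gaugeExp mu x : 𝔸ˣ) : 𝔸) = ((w x : 𝔸ˣ) : 𝔸) ∧ IsSelfAdjoint (mu x) ∧ ‖mu x‖ < cu) → (∀ x, x ∉ Ω 0 → mu x = 0) →
      (∀ j, j ≤ k → ∀ b ∈ {b : Site d × Fin d | SideTouches (Ω j) b.1 b.2}, ((L : ℝ) ^ j * η) * ‖covDerivFwd η U₀ b.2 mu b.1‖ < cu) →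
      LanF U₀ φ k (mgauge U₀ v⁻¹ (mgauge U₀ u₁⁻¹ U')) → Restr129 L k (Λs k) U₀ (u₁ * v) →
      LanF U₀ φ k (mgauge U₀ w⁻¹ (mgauge U₀ u₁⁻¹ U')) → Restr129 L k (Λs k) U₀ (u₁ * w) →
      ∀ x, v x = w x),
      ∀ α₀ α₁ : ℝ, 0 < α₀ → 0 < α₁ → α₀ + α₁ ≤ c₁ →
      ∀ U₀ U' : Site d → Fin d → 𝔸ˣ, (∀ x κ, U₀ x κ ∈ unitaryUnits 𝔸) → (∀ x κ, U' x κ ∈ unitaryUnits 𝔸) →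
      ∀ φ : Φ, Adm φ U₀ α₀ α₁ →
      InAk L k η α₀ Ω U₀ → InAk L k η α₀ Ω (mulCfg U' U₀) → (∀ m, m ≤ k → InAx L m (Λs m) U₀ (mulCfg U' U₀)) →
      (∀ j, j ≤ k → ∀ (z : Site d) (μ : Fin d),
        ((∀ x, InBox (tlo L z j) (thi L z j) x → x ∈ Ω j) ∨ (∀ x, InBox (tlo L (z + e μ) j) (thi L (z + e μ) j) x → x ∈ Ω j)) →
        ‖(avgIter L (mulCfg U' U₀) j z μ : 𝔸) - (avgIter L U₀ j z μ : 𝔸)‖ ≤ α₁) →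
      (∀ b ∈ {b : Site d × Fin d | SideTouches (Ω 0) b.1 b.2}, ‖((U' b.1 b.2 : 𝔸ˣ) : 𝔸) - 1‖ ≤ α₁) →
      ∃ u : Site d → 𝔸ˣ, (∀ x, u x ∈ unitaryUnits 𝔸) ∧ (∀ x, x ∉ Ω 0 → u x = 1) ∧ Restr129 L k (Λs k) U₀ u ∧
        (1 ≤ k → LanF U₀ φ k (mgauge U₀ u⁻¹ U')) ∧
        (∀ j, j ≤ k → ∀ b ∈ {b : Site d × Fin d | SideTouches (Ω j) b.1 b.2},
          mgauge U₀ u⁻¹ U' b.1 b.2 = cfgExp η (logCfg η (mgauge U₀ u⁻¹ U')) b.1 b.2 ∧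
            IsSelfAdjoint (logCfg η (mgauge U₀ u⁻¹ U') b.1 b.2) ∧
            ‖logCfg η (mgauge U₀ u⁻¹ U') b.1 b.2‖ ≤ (5 * (d : ℝ) * L * B₈ * (α₀ + α₁)) * ((L : ℝ) ^ j * η)⁻¹) ∧
        ∀ u' : Site d → 𝔸ˣ, (∀ x, u' x ∈ unitaryUnits 𝔸) → (∀ x, x ∉ Ω 0 → u' x = 1) → Restr129 L k (Λs k) U₀ u' →
          LanF U₀ φ k (mgauge U₀ u'⁻¹ U') →
          (∃ A' : Site d → Fin d → 𝔸, ∀ j, j ≤ k → ∀ (x : Site d) (κ : Fin d), SideTouches (Ω j) x κ →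
            mgauge U₀ u'⁻¹ U' x κ = cfgExp η A' x κ ∧ ‖A' x κ‖ ≤ (5 * (d : ℝ) * L * B₈ * (α₀ + α₁)) * ((L : ℝ) ^ j * η)⁻¹) →
          (1 ≤ k) → u' = u := by
  have hL1 : 1 ≤ L := le_trans (by norm_num) hL
  have hd1 : 1 ≤ d := le_trans (by norm_num) hd2
  have hd' : (1 : ℝ) ≤ d := by exact_mod_cast hd1
  have hL' : (1 : ℝ) ≤ L := by exact_mod_cast hL1
  obtain ⟨c₁, hc₁, hw⟩ := thm4_windows hd1 hL1 hB₈ hB₀' hB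
  obtain ⟨c₂, hc₂, hw'⟩ := thm4_windows_extra (d := d) hL1
  obtain ⟨cγ, hcγ, hwγ⟩ := thm4_windows_γ hd1 hL1 hB₈ hB₀' hB
  -- the threshold for Proposition 5's uniqueness radius: `2000·d·c⋆ ≤ cu`
  obtain ⟨c₃, hc₃def⟩ : ∃ c₃ : ℝ, c₃ = cu / (2000 * d * (5 * d * L * B₈)) := ⟨_, rfl⟩
  have hc₃ : 0 < c₃ := by rw [hc₃def]; positivity
  refine ⟨min (min (min c₁ c₂) (min cP c₃)) cγ, lt_min (lt_min (lt_min hc₁ hc₂) (lt_min hcP hc₃)) hcγ, ?_⟩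
  intro Adm LanF η hη k Ω hΩ Λs Λb hbox hclass htower hpart htw SP5base SP5 SH59src SP5u α₀ α₁ hα₀ hα₁ hS U₀ U' hU₀ hU' φ hφ h33 h34 hAx
    h135 h66
  have hSγ : α₀ + α₁ ≤ cγ := hS.trans (min_le_right _ _)
  replace hS : α₀ + α₁ ≤ min (min c₁ c₂) (min cP c₃) := hS.trans (min_le_left _ _)
  have hS1 : α₀ + α₁ ≤ c₁ := hS.trans ((min_le_left _ _).trans (min_le_left _ _))
  have hS2 : α₀ + α₁ ≤ c₂ := hS.trans ((min_le_left _ _).trans (min_le_right _ _))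
  have hSP : α₀ + α₁ ≤ cP := hS.trans ((min_le_right _ _).trans (min_le_left _ _))
  have hS3 : α₀ + α₁ ≤ c₃ := hS.trans ((min_le_right _ _).trans (min_le_right _ _))
  obtain ⟨g3, g4, g16, gsmall, gc₃, gC₂, g61⟩ :=
    hwγ α₀ α₁ hα₀ hα₁ hSγ (5 * (d : ℝ) * L * B₈ * (α₀ + α₁)) (8 * B₀' * (5 * (d : ℝ) * L * B₈) * (α₀ + α₁)) rfl rfl
  have hS0 : 0 ≤ α₀ + α₁ := by linarith
  obtain ⟨w1, w2, w3, w4, w5, w6, w7, w8, w9, w10, w11, w12, w13, w14, w15, w16, w17, w18⟩ :=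
    hw α₀ α₁ hα₀ hα₁ hS1 (5 * (d : ℝ) * L * B₈ * (α₀ + α₁)) (8 * B₀' * (5 * (d : ℝ) * L * B₈) * (α₀ + α₁)) rfl rfl
  obtain ⟨w19, w20⟩ := hw' α₀ α₁ hα₀ hα₁ hS2
  have hcs0 : 0 ≤ 5 * (d : ℝ) * L * B₈ * (α₀ + α₁) := by positivity
  have hα₄0 : 0 ≤ 8 * B₀' * (5 * (d : ℝ) * L * B₈) * (α₀ + α₁) := by positivity
  -- EXISTENCE (support form) at the top level `k`
  -- the source terms of the sourced in-edge and the enlarged reset constant `5dL·B₈ ≥ 5dL·B₀ + 2γ′B₀`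
  have hT0 : 0 ≤ γ' * B₀ * (α₀ + α₁) := by positivity
  have hc8 : 5 * (d : ℝ) * L * B₀ * (α₀ + α₁) + (γ' * B₀ * (α₀ + α₁) + γ' * B₀ * (α₀ + α₁)) ≤ 5 * (d : ℝ) * L * B₈ * (α₀ + α₁) := by
    have h := mul_le_mul_of_nonneg_right hγB hS0
    calc 5 * (d : ℝ) * L * B₀ * (α₀ + α₁) + (γ' * B₀ * (α₀ + α₁) + γ' * B₀ * (α₀ + α₁))
        = (5 * (d : ℝ) * L * B₀ + 2 * (γ' * B₀)) * (α₀ + α₁) := by ring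
      _ ≤ 5 * (d : ℝ) * L * B₈ * (α₀ + α₁) := h
  have w11' : 36 * d * B₀ * (2 * (L * (5 * (d : ℝ) * L * B₈ * (α₀ + α₁))) + 8 * (8 * B₀' * (5 * (d : ℝ) * L * B₈) * (α₀ + α₁))) ≤ 1 / 2 := by
    have hα₂0 : 0 ≤ 2 * (L * (5 * (d : ℝ) * L * B₈ * (α₀ + α₁))) + 8 * (8 * B₀' * (5 * (d : ℝ) * L * B₈) * (α₀ + α₁)) := by positivity
    have h : 36 * d * B₀ * (2 * (L * (5 * (d : ℝ) * L * B₈ * (α₀ + α₁))) + 8 * (8 * B₀' * (5 * (d : ℝ) * L * B₈) * (α₀ + α₁))) ≤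
        36 * d * B₈ * (2 * (L * (5 * (d : ℝ) * L * B₈ * (α₀ + α₁))) + 8 * (8 * B₀' * (5 * (d : ℝ) * L * B₈) * (α₀ + α₁))) := by
      have h36 : 36 * (d : ℝ) * B₀ ≤ 36 * (d : ℝ) * B₈ := mul_le_mul_of_nonneg_left hB₀8 (by positivity)
      exact mul_le_mul_of_nonneg_right h36 hα₂0
    exact h.trans w11
  obtain ⟨u, hu, huS, h129, W, hW, hLan, A, hA⟩ := thm4_exists_all_levels_supp_src_γ' hd2 hη hL k hU₀ hU' hα₀ hα₁ hα₄0 hB₀.le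
    hT0 hT0 hc8 w1 w2 w3 w4 g3 g4 w7 w8 gsmall gc₃ w11' w12 w19 g16 gC₂ g61 Ω hΩ Λs Λb hbox hclass h33 h34 hAx htw h135 h66 (LanF U₀ φ)
    (SP5base α₀ α₁ hα₀ hα₁ hSP U₀ U' hU₀ hU' φ hφ h33 h34 hAx h135 h66) (SP5 α₀ α₁ hα₀ hα₁ hSP U₀ U' hU₀ hU' φ hφ h33 h34 hAx h135 h66)
    (SH59src α₀ α₁ hα₀ hα₁ hSP U₀ U' hU₀ hU' φ hφ h33 h34 hAx h135 h66) k le_rfl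
  have hWeq : W = mgauge U₀ u⁻¹ U' := eq_mgauge_inv_of_mgauge_eq hW
  have hWu : ∀ x κ, W x κ ∈ unitaryUnits 𝔸 := mem_unitaryUnits_of_mgauge_eq hU₀ hU' hu hW
  -- `c⋆ ≤ 1/16` for the logarithm device
  have hc16 : 5 * (d : ℝ) * L * B₈ * (α₀ + α₁) ≤ 1 / 16 := by
    have h₁ : (1 : ℝ) * (5 * (d : ℝ) * L * B₈ * (α₀ + α₁)) ≤ L * (5 * (d : ℝ) * L * B₈ * (α₀ + α₁)) :=
      mul_le_mul_of_nonneg_right hL' hcs0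
    linarith
  -- the exponent read back as `logCfg`
  have hleaf : ∀ j, j ≤ k → ∀ b ∈ {b : Site d × Fin d | SideTouches (Ω j) b.1 b.2},
      mgauge U₀ u⁻¹ U' b.1 b.2 = cfgExp η (logCfg η (mgauge U₀ u⁻¹ U')) b.1 b.2 ∧
        IsSelfAdjoint (logCfg η (mgauge U₀ u⁻¹ U') b.1 b.2) ∧
        ‖logCfg η (mgauge U₀ u⁻¹ U') b.1 b.2‖ ≤ (5 * (d : ℝ) * L * B₈ * (α₀ + α₁)) * ((L : ℝ) ^ j * η)⁻¹ := by
    intro j hj b hb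
    obtain ⟨hexp, -, hbd⟩ := hA j hj b hb
    have hbd' : ‖A b.1 b.2‖ ≤ (5 * (d : ℝ) * L * B₈ * (α₀ + α₁)) * η⁻¹ := by
      refine hbd.trans ?_
      have hLj : (1 : ℝ) ≤ (L : ℝ) ^ j := one_le_pow₀ hL'
      have : ((L : ℝ) ^ j * η)⁻¹ ≤ η⁻¹ := by
        rw [mul_inv]
        calc ((L : ℝ) ^ j)⁻¹ * η⁻¹ ≤ 1 * η⁻¹ := by gcongr; exact inv_le_one_of_one_le₀ hLj
          _ = η⁻¹ := one_mul _
      exact mul_le_mul_of_nonneg_left this hcs0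
    obtain ⟨hlogA, hsa, hWexp⟩ := logField_spec hη U₀ hWu hexp hbd' hc16
    rw [← hWeq]
    refine ⟨hWexp, ?_, ?_⟩
    · simpa [logCfg] using hsa
    · show ‖logCfg η W b.1 b.2‖ ≤ _
      rw [logCfg, hlogA]
      exact hbd
  refine ⟨u, hu, huS, h129, fun hk => hWeq ▸ hLan hk, hleaf, ?_⟩
  -- UNIQUENESS: any other restricted u′ with (1.38) and the (1.62)-shape equals u
  intro u' hu' hu'S h129' hLan' h162' hk1
  have hk_Lan : LanF U₀ φ k (mgauge U₀ u⁻¹ U') := hWeq ▸ hLan hk1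
  have h162 : ∃ A₂ : Site d → Fin d → 𝔸, ∀ j, j ≤ k → ∀ (x : Site d) (κ : Fin d), SideTouches (Ω j) x κ →
      mgauge U₀ u⁻¹ U' x κ = cfgExp η A₂ x κ ∧ ‖A₂ x κ‖ ≤ (5 * (d : ℝ) * L * B₈ * (α₀ + α₁)) * ((L : ℝ) ^ j * η)⁻¹ := by
    refine ⟨A, fun j hj x κ hxκ => ?_⟩
    obtain ⟨hexp, -, hbd⟩ := hA j hj (x, κ) hxκ
    rw [← hWeq]
    exact ⟨hexp, hbd⟩
  -- the windows of the uniqueness clause at `c := c⋆`, `α_P := α₀`, and Prop. 5's radius `cu`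
  obtain ⟨cs, hcsdef⟩ : ∃ cs : ℝ, cs = 5 * (d : ℝ) * L * B₈ * (α₀ + α₁) := ⟨_, rfl⟩
  have hcs0' : 0 ≤ cs := by rw [hcsdef]; positivity
  have h2000 : 2000 * (d : ℝ) * cs ≤ cu := by
    have hden : 0 < 2000 * (d : ℝ) * (5 * d * L * B₈) := by positivity
    have h := (le_div_iff₀ hden).1 (hS3.trans (le_of_eq hc₃def))
    have e : 2000 * (d : ℝ) * cs = (α₀ + α₁) * (2000 * d * (5 * d * L * B₈)) := by rw [hcsdef]; ring
    linarith
  have hcu₂ : 5 * cs < cu := by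
    have h₁ : (1 : ℝ) * cs ≤ d * cs := mul_le_mul_of_nonneg_right hd' hcs0'
    have hdcs : 0 ≤ (d : ℝ) * cs := by positivity
    linarith
  have hcu₁ : 2 * (2 * (40 * d * cs) + 2 * 1116 * (40 * d * cs) ^ 2) < cu := by
    have hx0 : 0 ≤ 40 * d * cs := by positivity
    have hx1 : 40 * d * cs ≤ 1 / 5000 := by rw [hcsdef]; exact w16
    have hsq : (40 * d * cs) ^ 2 ≤ 40 * d * cs * (1 / 5000) := by rw [sq]; exact mul_le_mul_of_nonneg_left hx1 hx0
    have hdcs : 0 ≤ (d : ℝ) * cs := by positivity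
    linarith
  rw [hcsdef] at hcu₁ hcu₂
  exact thm4_unique_eq_lanE (Lan := LanF U₀ φ k) hd2 hL hη hU₀ hU' hu' hu hα₀ w5 w6 hcs0 w18 w17 w15 w16 hα₀ w5 w20 hcu₁ hcu₂ h33
    (by rw [← mulCfg_eq_mul]; exact h34) (by rw [← mulCfg_eq_mul]; exact hAx k le_rfl) htower h129' h129 hLan' hk_Lan h162' h162
    (SP5u α₀ α₁ hα₀ hα₁ hSP U₀ U' hU₀ hU' φ hφ h33 h34 hAx h135 h66 u' hu' hu'S h129' hLan' h162') hpart hu'S huS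

end Main

#print axioms thm4Body_concrete_uniform_lanE_γ'

end Literature.MathematicalPhysics.QuantumFieldTheory.Balaban1983to89.B8Thm4ConcreteLanEGamma

end
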